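import Mathlib
import HarnessLib
import Summits.BirchSwinnertonDyer.BirchSwinnertonDyer.Theses.ManinLocalTwoThree
import Summits.BirchSwinnertonDyer.BirchSwinnertonDyer.Theorems.ManinLocalTwoThreeFreyTwistShapeConductorAtTwo
import Literature.NumberTheory.Automorphic.UnboundedDenominators

/-!
# Lines/kummer_diamond_candidate.lean — (p2 gen 21, 2026-08-30): C2 `ManinOddAtFour` ⟸ CDT THEOREM 1 (printed) ∧ E-es-185 (paper theorem, es §59.5).
# es g38's KUMMER–DIAMOND line (I-es-g38-1 / MEMO-es §59): the index-4 world `Λ₁(f) = 2Λ₀(f)` — the whole residual of C2 modulo the integer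
# c-division chain (p2 g21 `CDivisionInt`, p756488) — is EMPTY: E-es-185 `IndexFourForcesFreyTwistShape` (index 4 ⟹ 2⁵ ∣ N ∧ Frey-twist shape
# y² = x(x − 2s²)(x − t²), s even, t odd; THEOREM K = Kummer–diamond reciprocity at the Atkin–Lehner cusps + LEMMA M + 2-descent signs) and E-es-186
# (such a curve has f₂ = 4 — now a KERNEL THEOREM: p2 g21 `FreyTwistConductor.freyTwistShapeConductorExponentTwoLaw_holds`, p758063, Tate family C;
# modularity = the crux's own fourth binder turns it into `FreyTwistShapeTwoAdicLaw`).  TWO stubs: `stub_CDT` (PRINTED: Calegari–Dimitrov–Tang Thm 1.0.1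
# verbatim, ℤ-coefficients) and `stub_indexFourForcesFreyTwistShape` (E-es-185 BY NAME; paper-proved es §59.5/§59.13(b), ref1 §R215 SOUND; Lean needs
# Stevens 1982 Thm 1.3.1(b) on X₁(N)-cusps).  Composition `FreyTwistConductor.maninOddAtFour_of_CDTInt_shape185`.
# HONEST FRAMING: CONDITIONAL reduction; CDT Thm 1 printed/statement-only; E-es-185 OPEN in Lean; BSD is not proved; Manin's conjecture is not proved.
-/

set_option autoImplicit false
set_option linter.dupNamespace false

noncomputable section

namespace Summit.BirchSwinnertonDyer.BirchSwinnertonDyer.Cruxes.ManinOddAtFour.KummerDiamondLine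

/-- STUB (PRINTED) CDT Theorem 1 — Calegari–Dimitrov–Tang 2025, Thm. 1.0.1 VERBATIM (rational-integer coefficients); CITE-ONLY. [cite: CalegariDimitrovTang2025, Thm. 1.0.1] -/
theorem stub_CDT : Literature.NumberTheory.Automorphic.CalegariDimitrovTang2025_unboundedDenominators := by
  sorry

/-- STUB (LAW) E-es-185 `IndexFourForcesFreyTwistShape` (es g38's row BY NAME, `…/ManinAdditive/KummerDiamondShapeLaws.lean`): in the index-4 configuration of a
lattice-optimal X₀(N)-datum of a globally minimal curve, `2⁵ ∣ N` and the curve is ℚ-isomorphic to `y² = x(x − 2s²)(x − t²)`, `s` even, `t` odd.  PAPER THEOREM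
(MEMO-es §59.5 STEP 1–3 + §59.13(b); ref1 §R215); OPEN in Lean (needs THEOREM K: Galois action on the cusps of X₁(N), Stevens 1982 Thm. 1.3.1(b)). -/
theorem stub_indexFourForcesFreyTwistShape :
    Summit.BirchSwinnertonDyer.Rank1Residual.ManinAdditive.KummerDiamond.IndexFourForcesFreyTwistShape := by
  sorry

/-- COMPOSITION (no sorry): `FreyTwistConductor.maninOddAtFour_of_CDTInt_shape185` (p2 g21, p758063; E-es-186♭ proved there, E-an-152b/152c and the integer
c-division chain p756488 inside). -/
theorem ManinOddAtFour_of :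
    Summit.BirchSwinnertonDyer.BirchSwinnertonDyer.Theses.ManinLocalTwoThree.ManinOddAtFour :=
  Summit.BirchSwinnertonDyer.BirchSwinnertonDyer.Theorems.ManinLocalTwoThree.FreyTwistConductor.maninOddAtFour_of_CDTInt_shape185
    stub_CDT stub_indexFourForcesFreyTwistShape

end Summit.BirchSwinnertonDyer.BirchSwinnertonDyer.Cruxes.ManinOddAtFour.KummerDiamondLine

end
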